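import Summits.ValiantsHypothesis.ValiantsHypothesis.Theorems.DefinabilityGapPivotRandom
import Literature.Computability.Complexity.HardCoreMinMax
import HarnessLib

/-!
# Definability gap, ROAD P: Phase A bookkeeping (N1 plan v2 (a)–(b))

The pieces that turn the Bernstein dictionary (`DefinabilityGapPivotRandom`) into an existence
statement (NODE-v7 §H, lens-5 g7):

* §1 **Probabilistic method under a product law** — if the bad assignments have
  `prodWeight w`-weight `< 1`, some assignment in the SUPPORT of `w` is good
  (`exists_support_not_mem_of_weight_lt_one`); union bound re-exported from the tree
  (`Literature.Computability.Complexity.HardCoreMinMax.sum_biUnion_le_sum`).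
* §2 **The uniform admissible law** `admWeight A c a = [a ∈ A c] / #(A c)`: a product law whose
  support is `∀ c, r c ∈ A c`, with point weights `≤ 1 / #(A c)`.
* §3 **Means by incidence** — the double count
  `Σ_{c' ∈ T \ {c}} rowOverlap c c' i = Σ_j #coCurves T c (i, j)` (`sum_rowOverlap_eq`) and the
  mean bound `mean(row-i kill sum) ≤ p · Σ_j #coCurves T c (i, j)` when all point weights at row
  `i` are `≤ p` (`mean_rowKill_le`); the column analogue `mean_colKill_le`.
-/

namespace Summit.ValiantsHypothesis.ValiantsHypothesis.Theorems.DefinabilityGapPivotPhaseA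

open Finset Real
open Literature.Computability.AlgebraicComplexity Literature.Computability.MetaComplexity
open Literature.Probability.Moments
open Summit.ValiantsHypothesis.ValiantsHypothesis.Theorems.DefinabilityGapAffineRung
open Summit.ValiantsHypothesis.ValiantsHypothesis.Theorems.DefinabilityGapPivotCertificate
open Summit.ValiantsHypothesis.ValiantsHypothesis.Theorems.DefinabilityGapPivotLive
open Summit.ValiantsHypothesis.ValiantsHypothesis.Theorems.DefinabilityGapPivotAdmissible
open Summit.ValiantsHypothesis.ValiantsHypothesis.Theorems.DefinabilityGapPivotRandom

/-! ## §1 The probabilistic method under a product law -/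

section ProbMethod

variable {ι Γ : Type*} [Fintype ι]

/-- **Probabilistic method, support form**: if the bad points have `prodWeight w`-weight `< 1`,
there is a point outside `bad` all of whose coordinates carry positive weight. [lens-5 g7] -/
theorem exists_support_not_mem_of_weight_lt_one [DecidableEq ι] [Fintype Γ] [DecidableEq Γ]
    {w : ι → Γ → ℝ} (hw : ∀ i a, 0 ≤ w i a) (hw1 : ∀ i, ∑ a, w i a = 1)
    (bad : Finset (ι → Γ))
    (h : ∑ y ∈ bad, prodWeight w y < 1) : ∃ y, y ∉ bad ∧ ∀ i, 0 < w i (y i) := by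
  classical
  have htot := sum_prodWeight (ι := ι) (Γ := Γ) hw1
  have hsplit :
      ∑ y ∈ (Finset.univ : Finset (ι → Γ)).filter (fun y => y ∉ bad), prodWeight w y =
        1 - ∑ y ∈ bad, prodWeight w y := by
    have := Finset.sum_filter_add_sum_filter_not (Finset.univ : Finset (ι → Γ))
      (fun y => y ∈ bad) (prodWeight w)
    rw [htot] at this
    have hb : (Finset.univ : Finset (ι → Γ)).filter (fun y => y ∈ bad) = bad := by
      ext y; simp
    rw [hb] at this
    linarith
  have hpos : 0 < ∑ y ∈ (Finset.univ : Finset (ι → Γ)).filter (fun y => y ∉ bad),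
      prodWeight w y := by
    rw [hsplit]; linarith
  have h0 : ∑ _y ∈ (Finset.univ : Finset (ι → Γ)).filter (fun y => y ∉ bad), (0 : ℝ) <
      ∑ y ∈ (Finset.univ : Finset (ι → Γ)).filter (fun y => y ∉ bad), prodWeight w y := by
    rwa [Finset.sum_const_zero]
  obtain ⟨y, hy, hyw⟩ := Finset.exists_lt_of_sum_lt h0
  refine ⟨y, (Finset.mem_filter.mp hy).2, fun i => ?_⟩
  rcases (hw i (y i)).lt_or_eq with hlt | heq
  · exact hlt
  · exfalso
    have : prodWeight w y = 0 := by
      unfold prodWeight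
      exact Finset.prod_eq_zero (Finset.mem_univ i) heq.symm
    rw [this] at hyw
    exact lt_irrefl _ hyw

/-- Union bound for nonnegative weights (re-export of the tree's `sum_biUnion_le_sum`).
[lens-5 g7] -/
theorem weight_biUnion_le [DecidableEq Γ] {α : Type*} (S : Finset α)
    (B : α → Finset (ι → Γ))
    {w : ι → Γ → ℝ} (hw : ∀ i a, 0 ≤ w i a) :
    ∑ y ∈ S.biUnion B, prodWeight w y ≤ ∑ k ∈ S, ∑ y ∈ B k, prodWeight w y :=
  Literature.Computability.Complexity.HardCoreMinMax.sum_biUnion_le_sum S B (prodWeight w)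
    (prodWeight_nonneg hw)

end ProbMethod

/-! ## §2 The uniform admissible law -/

section Adm

variable {ι Γ : Type*} [DecidableEq Γ]

/-- The uniform law on the admissible values `A i` of coordinate `i`. [lens-5 g7] -/
noncomputable def admWeight (A : ι → Finset Γ) (i : ι) (a : Γ) : ℝ :=
  if a ∈ A i then 1 / (A i).card else 0

/-- `admWeight ≥ 0`. [lens-5 g7] -/
theorem admWeight_nonneg (A : ι → Finset Γ) (i : ι) (a : Γ) : 0 ≤ admWeight A i a := by
  unfold admWeight
  split_ifs <;> positivity

/-- `admWeight` sums to `1` on each coordinate with nonempty admissible set. [lens-5 g7] -/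
theorem sum_admWeight [Fintype Γ] (A : ι → Finset Γ) (hA : ∀ i, (A i).Nonempty) (i : ι) :
    ∑ a, admWeight A i a = 1 := by
  unfold admWeight
  rw [Finset.sum_ite, Finset.sum_const_zero, add_zero, Finset.sum_const]
  have hc : ((Finset.univ : Finset Γ).filter fun a => a ∈ A i) = A i := by ext a; simp
  rw [hc, nsmul_eq_mul]
  have : ((A i).card : ℝ) ≠ 0 := by exact_mod_cast (hA i).card_pos.ne'
  field_simp

/-- Point weights of `admWeight` are at most `1 / #(A i)`. [lens-5 g7] -/
theorem admWeight_le (A : ι → Finset Γ) (i : ι) (a : Γ) :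
    admWeight A i a ≤ 1 / (A i).card := by
  unfold admWeight
  split_ifs
  · exact le_rfl
  · positivity

/-- Positive weight means admissible: the support of `admWeight A` is `∀ i, y i ∈ A i`.
[lens-5 g7] -/
theorem mem_of_admWeight_pos (A : ι → Finset Γ) {i : ι} {a : Γ} (h : 0 < admWeight A i a) :
    a ∈ A i := by
  unfold admWeight at h
  by_contra hn
  rw [if_neg hn] at h
  exact lt_irrefl _ h

/-- **Existence of an admissible good assignment**: if under the uniform admissible law the bad
assignments weigh `< 1`, some assignment with `y i ∈ A i` for all `i` is good. [lens-5 g7] -/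
theorem exists_adm_not_mem [Fintype ι] [DecidableEq ι] [Fintype Γ] (A : ι → Finset Γ)
    (hA : ∀ i, (A i).Nonempty) (bad : Finset (ι → Γ))
    (h : ∑ y ∈ bad, prodWeight (admWeight A) y < 1) :
    ∃ y, y ∉ bad ∧ ∀ i, y i ∈ A i := by
  obtain ⟨y, hy, hpos⟩ := exists_support_not_mem_of_weight_lt_one (admWeight_nonneg A)
    (sum_admWeight A hA) bad h
  exact ⟨y, hy, fun i => mem_of_admWeight_pos A (hpos i)⟩

end Adm

/-! ## §3 Means by incidence -/

variable {m : ℕ}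

/-- **Double count**: the row-`i` overlaps of `c` with the other curves of `T` add up to the
row-`i` incidence `Σ_j #coCurves T c (i, j)`. [lens-5 g7] -/
theorem sum_rowOverlap_eq (T : Finset (Fin 3 → Fin (qOf m))) (c : Fin 3 → Fin (qOf m))
    (i : Fin m) :
    ∑ c' ∈ T.erase c, rowOverlap c c' i = ∑ j : Fin m, (coCurves T c (i, j)).card := by
  classical
  have key : ∀ j : Fin m,
      ((T.erase c).filter fun c' => cellEmb m c' (i, j) = cellEmb m c (i, j)) =
        coCurves T c (i, j) := by
    intro j
    ext c'
    simp only [Finset.mem_filter, Finset.mem_erase, mem_coCurves]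
    tauto
  unfold rowOverlap
  simp_rw [Finset.card_filter]
  rw [Finset.sum_comm]
  refine Finset.sum_congr rfl fun j _ => ?_
  rw [← key j, Finset.card_filter]

/-- **Mean of the row kill sum by incidence**: if every point weight at row `i` is `≤ p`
the mean of the row-`i` kill sum of `c` is `≤ p · Σ_j #coCurves T c (i, j)`.
[lens-5 g7] -/
theorem mean_rowKill_le {w : (Fin 3 → Fin (qOf m)) → Fin m → ℝ} {p : ℝ}
    (hwp : ∀ c', w c' ≤ fun _ => p) (T : Finset (Fin 3 → Fin (qOf m)))
    (c : Fin 3 → Fin (qOf m)) (i : Fin m) :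
    ∑ c' : Fin 3 → Fin (qOf m), ∑ a : Fin m, w c' a * rowKill T c i c' a ≤
      p * ∑ j : Fin m, ((coCurves T c (i, j)).card : ℝ) := by
  rw [sum_mean_rowKill]
  calc ∑ c' ∈ T.erase c, w c' i * (rowOverlap c c' i : ℝ)
      ≤ ∑ c' ∈ T.erase c, p * (rowOverlap c c' i : ℝ) :=
        Finset.sum_le_sum fun c' _ =>
          mul_le_mul_of_nonneg_right (hwp c' i) (Nat.cast_nonneg _)
    _ = p * ∑ j : Fin m, ((coCurves T c (i, j)).card : ℝ) := by
        rw [← Finset.mul_sum, ← Nat.cast_sum, sum_rowOverlap_eq, Nat.cast_sum]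

/-- **Mean of the column kill sum**:
`Σ_{c'} Σ_a w c' a · colKill T c j c' a = Σ_{c' ≠ c} Σ_a w c' a · [coincide at (a, j)]`,
hence `≤ p · Σ_a #coCurves T c (a, j)` if all point weights are `≤ p`. [lens-5 g7] -/
theorem mean_colKill_le {w : (Fin 3 → Fin (qOf m)) → Fin m → ℝ} {p : ℝ} (hp : 0 ≤ p)
    (hwp : ∀ c', w c' ≤ fun _ => p)
    (T : Finset (Fin 3 → Fin (qOf m))) (c : Fin 3 → Fin (qOf m)) (j : Fin m) :
    ∑ c' : Fin 3 → Fin (qOf m), ∑ a : Fin m, w c' a * colKill T c j c' a ≤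
      p * ∑ a : Fin m, ((coCurves T c (a, j)).card : ℝ) := by
  classical
  -- pointwise: `w c' a · colKill ≤ p · [c' ∈ coCurves T c (a, j)]`
  have hpt : ∀ (c' : Fin 3 → Fin (qOf m)) (a : Fin m), w c' a * colKill T c j c' a ≤
      p * (if c' ∈ coCurves T c (a, j) then 1 else 0) := by
    intro c' a
    unfold colKill
    by_cases h : c' ∈ T ∧ c' ≠ c ∧ cellEmb m c' (a, j) = cellEmb m c (a, j)
    · rw [if_pos h, if_pos (mem_coCurves.mpr h), mul_one, mul_one]
      exact hwp c' a
    · rw [if_neg h, mul_zero]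
      split_ifs <;> positivity
  calc ∑ c' : Fin 3 → Fin (qOf m), ∑ a : Fin m, w c' a * colKill T c j c' a
      ≤ ∑ c' : Fin 3 → Fin (qOf m), ∑ a : Fin m,
          p * (if c' ∈ coCurves T c (a, j) then (1 : ℝ) else 0) :=
        Finset.sum_le_sum fun c' _ => Finset.sum_le_sum fun a _ => hpt c' a
    _ = p * ∑ a : Fin m, ((coCurves T c (a, j)).card : ℝ) := by
        rw [Finset.sum_comm, Finset.mul_sum]
        refine Finset.sum_congr rfl fun a _ => ?_
        rw [← Finset.mul_sum, Finset.sum_boole, Finset.filter_univ_mem]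

end Summit.ValiantsHypothesis.ValiantsHypothesis.Theorems.DefinabilityGapPivotPhaseA
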